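import Literature.NumberTheory.Sieve.LargestPrimeFactorCubicS1Family
import Literature.NumberTheory.Sieve.LargestPrimeFactorCubicS1Progression
import Literature.NumberTheory.Sieve.LargestPrimeFactorCubic
import HarnessLib

/-!
# Heath-Brown 2001, §5: the exponential sums `σ(n)` of a family through Theorem 2

Fifteenth proved layer of this seat under the named fact `HeathBrown2001_largestPrimeFactor_cubic`
(`LargestPrimeFactorCubic.lean`; D. R. Heath-Brown, *The largest prime factor of `X³ + 2`*, Proc.
London Math. Soc. (3) 82 (2001) 554–596).  §5 (pp. 571–573) puts the sums `σ(n)` of Lemma 4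
"into a shape suitable for Theorem 2": with `c = c₃ + m rs N(KA)`, `g(X) = c₄ − a rs N(KA) X`,
"`(C, q) = 1` if and only if `(g(m), q') = 1`, where `q' = q(rs)⁻¹`. Moreover
`C̄^{(q)} ≡ rs (rs)‾^{(q')} ḡ(m)^{(q')} + q'c₅ (mod q)` … If we now set `w = −nab (rs)‾^{(q')}` we may
conclude that `σ(n) = e_{rs}(−nabc₅) ∑_m e_{q'}(w ḡ(m)^{(q')}) e(nX'/N(α))`", then removes
`e(nX'/N(α))` by partial summation and applies **Theorem 2 with `k = 2`, `D = 1`** ("We have `p > 4`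
for all `p ∣ q'`, by (2.16). Since `f(X) = 1` and `g(X)` is non-constant modulo any prime factor `p`
of `q'`, the hypotheses of the theorem are satisfied. We shall take `q₁' = q₁/(rs, q₁)` and
`q₂' = q₂/(rs, q₂)`, whence `q₁'q₂' ∣ q'`").

This file PROVES the corresponding bound for the sums `sigmaF` of `…S1Family`, CONDITIONALLY on the
named fact `HeathBrown2001_thm2_shortKloosterman` (Theorem 2), following the printed route with two
adjustments recorded in `…Setup`/NOTES: the condition `(D, q) = 1` of (2.11) is removed by Möbius
inversion over `s ∣ q` alone (the `r`-inversion of the paper is not needed: the condition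
`(C, q) = 1` is exactly the summation convention of Theorem 2), and the progression is a single
interval (one cube).  Main statement: `norm_sigmaF_le` — for `h ≠ 0`, `Y ≤ 2X`, a root class `j` of
an odd `e` coprime to `q`, and the constant `C = C(2, 1, ε)` of Theorem 2,

  `|σ_Y(h)| ≤ ∑_{s ∣ q} (1 + (3/20)|h|) C (q/s)^ε [B_s (Δ/q₀)^{1/8} + B_s^{3/4} q₀^{1/8}
      + B_s^{1/2} q₂'^{1/2} + B_s^{3/4} q₁'^{1/4}]`,

`B_s = t/(100es) + 1`, `q₁' = q₁` or `1` according as `q₁ ∤ s` or `q₁ ∣ s` (likewise `q₂'`),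
`q₀ = q/(s q₁'q₂')`, `Δ ≤ (q, h)` (and the family is empty, `σ = 0`, unless `(e, 2q) = 1`).

## References

* D. R. Heath-Brown, *The largest prime factor of `X³ + 2`*, Proc. London Math. Soc. (3) 82 (2001)
  554–596, §5 pp. 571–573, Theorem 2 (p. 555). [`HeathBrown2001LargestPrimeFactorCubic`]
-/

noncomputable section

open NumberField Finset Real Polynomial
open scoped FourierTransform

namespace Literature.NumberTheory.Sieve.LargestPrimeFactorCubic

open LFunctions.CubeRootTwoField CubicSieve

/-! ### Generic tools: Möbius inversion, `e(z/q)` through `ZMod q`, CRT splitting -/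

/-- `∑_{s ∣ n} μ(s) = [n = 1]` in `ℂ`. [folklore] -/
theorem sum_divisors_moebius_complex (n : ℕ) :
    ∑ s ∈ n.divisors, ((ArithmeticFunction.moebius s : ℤ) : ℂ) = if n = 1 then 1 else 0 := by
  have h := congrArg (fun f : ArithmeticFunction ℂ => f n)
    (ArithmeticFunction.coe_moebius_mul_coe_zeta (R := ℂ))
  simpa only [ArithmeticFunction.coe_mul_zeta_apply, ArithmeticFunction.intCoe_apply,
    ArithmeticFunction.one_apply] using h

/-- `e(z/q) = exp(2πi · (z mod q)/q)` for `q ≥ 1`, `z ∈ ℤ`: the phase depends on `z` only through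
its class in `ℤ/q`, read through `ZMod.val`. [folklore] -/
theorem fourierChar_intCast_div_eq_exp {q : ℕ} (hq : 0 < q) (z : ℤ) :
    (𝐞 ((z : ℝ) / q) : ℂ) =
      Complex.exp ((2 * Real.pi * ((((z : ZMod q)).val : ℕ) : ℝ) / q : ℝ) * Complex.I) := by
  haveI : NeZero q := ⟨hq.ne'⟩
  have hval : (((z : ZMod q)).val : ℤ) = z % q := ZMod.val_intCast z
  have hz : (z : ℝ) / q = ((((z : ZMod q)).val : ℕ) : ℝ) / q + ((z / q : ℤ) : ℝ) := by
    have e1 : ((q : ℤ) * (z / q) + z % q : ℤ) = z := Int.mul_ediv_add_emod z q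
    have e2 : (z : ℝ) = (q : ℝ) * ((z / q : ℤ) : ℝ) + ((z % q : ℤ) : ℝ) := by exact_mod_cast e1.symm
    have hq0 : (q : ℝ) ≠ 0 := by exact_mod_cast hq.ne'
    rw [show ((((z : ZMod q)).val : ℕ) : ℝ) = ((z % q : ℤ) : ℝ) by exact_mod_cast hval, e2]
    field_simp
    ring
  rw [hz, FejerCounting.fourierChar_add_intCast, Real.fourierChar_apply]
  congr 1
  push_cast
  ring

/-- CRT splitting of a phase: if `sσ + q'τ ≡ 1 (mod q's)` then for every integer `x`,
`e(x/(q's)) = e(σx/q') e(τx/s)`. [cite: HeathBrown2001LargestPrimeFactorCubic, §5 p. 572] -/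
theorem fourierChar_crt_split {q' s : ℕ} (hq' : 0 < q') (hs : 0 < s) {σ τ : ℤ}
    (h1 : (s : ℤ) * σ + q' * τ ≡ 1 [ZMOD (q' * s : ℕ)]) (x : ℤ) :
    (𝐞 ((x : ℝ) / ((q' * s : ℕ) : ℝ)) : ℂ) = 𝐞 ((σ * x : ℤ) / (q' : ℝ)) * 𝐞 ((τ * x : ℤ) / (s : ℝ)) := by
  obtain ⟨m, hm⟩ := (Int.ModEq.dvd h1.symm : ((q' * s : ℕ) : ℤ) ∣ (s : ℤ) * σ + q' * τ - 1)
  have hq0 : (q' : ℝ) ≠ 0 := by exact_mod_cast hq'.ne'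
  have hs0 : (s : ℝ) ≠ 0 := by exact_mod_cast hs.ne'
  have key : (x : ℝ) / ((q' * s : ℕ) : ℝ) + ((m * x : ℤ) : ℝ) = (σ * x : ℤ) / (q' : ℝ) + (τ * x : ℤ) / (s : ℝ) := by
    have hm' : (s : ℝ) * σ + q' * τ - 1 = (q' : ℝ) * s * m := by exact_mod_cast hm
    push_cast
    field_simp
    linear_combination (-(x : ℝ)) * hm'
  rw [← FejerCounting.fourierChar_add_intCast _ (m * x), key, AddChar.map_add_eq_mul, Circle.coe_mul]

/-! ### The family is empty unless `(e, 2q) = 1` -/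

section Family

variable {X : ℕ} {P : ℕ → Finset (ℕ × ℕ)}

/-- For `α_c ∈ gens` in the family of modulus `e` and root `j ∈ roots(e)`: `e ∣ N(α_c)`.
[cite: HeathBrown2001LargestPrimeFactorCubic, §4 p. 570] -/
theorem dvd_normNat_of_mem_famF {i : ℕ} {ab : ℕ × ℕ} {e j c : ℕ} (he : 0 < e) (hj : j ∈ roots e)
    (hc : c ∈ famF X i ab e j) : e ∣ normNat (ab.1, ab.2, c) := by
  rw [roots, mem_filter] at hj
  rw [famF, mem_filter] at hc
  rw [← absNorm_genIdeal]
  exact dvd_absNorm_of_root he hj.2 hc.2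

/-- The family is empty unless `e` is odd and coprime to `q` (`N(α)` is odd, `a` being odd, and
`(N(α), q) = 1` by (3.1)). [cite: HeathBrown2001LargestPrimeFactorCubic, (3.1)] -/
theorem famF_eq_empty_of_not_coprime (hP : ∀ i, P i ⊆ basePairs X i) {i : ℕ} (hi : i ∈ scales X)
    {ab : ℕ × ℕ} (hab : ab ∈ P i) {e j : ℕ} (he : 0 < e) (hj : j ∈ roots e)
    (hbad : ¬ Nat.Coprime e (2 * (qf ab.1 ab.2).natAbs)) : famF X i ab e j = ∅ := by
  by_contra hne
  obtain ⟨c, hc⟩ := nonempty_iff_ne_empty.2 hne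
  have hv := mem_gens_of_mem_famF hi hab hc
  have hdvd := dvd_normNat_of_mem_famF he hj hc
  obtain ⟨h2, hC, hD⟩ := isCoprime_of_mem_gens hP hv
  have hNq := isCoprime_norm_q h2 hC hD
  apply hbad
  rw [Nat.coprime_mul_iff_right]
  constructor
  · -- `N(α)` is odd
    have hcast := normNat_cast_of_mem_gens hP hv
    have hodd : ¬ (2 : ℤ) ∣ normf (ab.1, ab.2, c) := by
      intro h2N
      -- `2 ∣ N ⇒ 2 ∣ a³ ⇒ 2 ∣ a`, but `a` odd (as `(2, q) = 1`, `q ≡ a³`)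
      have ha : ¬ (2 : ℤ) ∣ (ab.1 : ℤ) ^ 3 := by
        intro ha
        have : (2 : ℤ) ∣ (ab.1 : ℤ) ^ 3 - 2 * (ab.2 : ℤ) ^ 3 := dvd_sub ha (dvd_mul_right _ _)
        exact (Int.prime_two.not_unit) (h2.isUnit_of_dvd' (dvd_refl _) this) |> fun h => h
      apply ha
      have e1 : (ab.1 : ℤ) ^ 3 = normf (ab.1, ab.2, c) - 2 * ((ab.2 : ℤ) ^ 3 + 2 * (c : ℤ) ^ 3 - 3 * ab.1 * ab.2 * c) := by
        simp only [normf]; ring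
      rw [e1]
      exact dvd_sub h2N (dvd_mul_right _ _)
    refine ((Nat.Prime.coprime_iff_not_dvd Nat.prime_two).2 ?_).symm
    rintro ⟨k, hk⟩
    apply hodd
    rw [← hcast]
    have : (2 : ℕ) ∣ normNat (ab.1, ab.2, c) := (Dvd.intro k hk.symm).trans hdvd
    exact_mod_cast this
  · have h1 : IsCoprime ((normNat (ab.1, ab.2, c) : ℕ) : ℤ) (qf ab.1 ab.2) := by
      rw [normNat_cast_of_mem_gens hP hv]; exact hNq
    have h2' : IsCoprime (e : ℤ) (qf ab.1 ab.2) := h1.of_isCoprime_of_dvd_left (by exact_mod_cast hdvd)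
    rw [Int.isCoprime_iff_gcd_eq_one, Int.gcd, Int.natAbs_natCast] at h2'
    exact h2'

/-! ### Coprimality of `a`, `b` with `q` -/

/-- For a base pair: `(a, q) = (b, q) = 1` ("(2.14) `(a, b) = (2ab, q) = 1`", from `q` squarefree and
odd). [cite: HeathBrown2001LargestPrimeFactorCubic, (2.14)] -/
theorem isCoprime_ab_q {X : ℕ} {ab : ℕ × ℕ} (h : IsBasePair X ab) :
    IsCoprime (ab.1 : ℤ) (qf ab.1 ab.2) ∧ IsCoprime (ab.2 : ℤ) (qf ab.1 ab.2) := by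
  obtain ⟨hsq, h6, -⟩ := h
  obtain ⟨a, b⟩ := ab
  simp only at hsq h6 ⊢
  -- a prime dividing `q` and `a` (or `b`) divides both `a` and `b`, so its cube divides `q`
  have key : ∀ p : ℕ, p.Prime → (p : ℤ) ∣ qf a b → ((p : ℤ) ∣ a ∨ (p : ℤ) ∣ b) → False := by
    intro p hp hpq hpab
    have hp' : Prime (p : ℤ) := Nat.prime_iff_prime_int.1 hp
    have hp2 : p ≠ 2 := by
      rintro rfl
      have : (2 : ℕ) ∣ (qf a b).natAbs := by
        have := hpq; rwa [Int.natCast_dvd] at this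
      have h2 := Nat.Coprime.coprime_dvd_right (show 2 ∣ 6 by norm_num) h6
      exact absurd (h2.symm.eq_one_of_dvd this) (by norm_num)
    have hboth : (p : ℤ) ∣ a ∧ (p : ℤ) ∣ b := by
      rcases hpab with hpa | hpb
      · refine ⟨hpa, ?_⟩
        have h1 : (p : ℤ) ∣ 2 * (b : ℤ) ^ 3 := by
          have : (p : ℤ) ∣ (a : ℤ) ^ 3 - qf a b := by
            exact dvd_sub (dvd_pow hpa (by norm_num)) hpq
          simpa [qf] using this
        rcases hp'.dvd_or_dvd h1 with h2 | h2
        · exfalso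
          have : (p : ℤ) ∣ 2 := h2
          have hle := Int.le_of_dvd (by norm_num) this
          have hge : (2 : ℤ) ≤ p := by exact_mod_cast hp.two_le
          have : (p : ℤ) = 2 := le_antisymm hle hge
          exact hp2 (by exact_mod_cast this)
        · exact hp'.dvd_of_dvd_pow h2
      · refine ⟨?_, hpb⟩
        have h1 : (p : ℤ) ∣ (a : ℤ) ^ 3 := by
          have : (p : ℤ) ∣ qf a b + 2 * (b : ℤ) ^ 3 := dvd_add hpq (dvd_mul_of_dvd_right (dvd_pow hpb (by norm_num)) _)
          simpa [qf] using this
        exact hp'.dvd_of_dvd_pow h1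
    obtain ⟨⟨u, hu⟩, ⟨v, hv⟩⟩ := hboth
    have hp3 : ((p ^ 2 : ℕ) : ℤ) ∣ qf a b := ⟨p * (u ^ 3 - 2 * v ^ 3), by simp only [qf, hu, hv]; push_cast; ring⟩
    have hp3' : p ^ 2 ∣ (qf a b).natAbs := by
      rw [← Int.natCast_dvd_natCast]; rw [Int.dvd_natAbs]; exact hp3
    have := hsq p (by simpa [pow_two] using hp3')
    exact hp.one_lt.ne' (Nat.isUnit_iff.1 this)
  constructor
  · rw [Int.isCoprime_iff_gcd_eq_one]
    by_contra hne
    obtain ⟨p, hp, hpd⟩ := Nat.exists_prime_and_dvd hne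
    have h1 : (p : ℤ) ∣ (Int.gcd (a : ℤ) (qf a b) : ℤ) := by exact_mod_cast hpd
    exact key p hp (h1.trans (Int.gcd_dvd_right _ _)) (Or.inl (h1.trans (Int.gcd_dvd_left _ _)))
  · rw [Int.isCoprime_iff_gcd_eq_one]
    by_contra hne
    obtain ⟨p, hp, hpd⟩ := Nat.exists_prime_and_dvd hne
    have h1 : (p : ℤ) ∣ (Int.gcd (b : ℤ) (qf a b) : ℤ) := by exact_mod_cast hpd
    exact key p hp (h1.trans (Int.gcd_dvd_right _ _)) (Or.inr (h1.trans (Int.gcd_dvd_left _ _)))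

/-! ### The class of `c` modulo `es` -/

/-- `j ∈ roots(e)` is invertible modulo an odd `e` (`(j, e) ∣ 2`). [folklore] -/
theorem isCoprime_root {e j : ℕ} (hodd : Nat.Coprime e 2) (hj : j ∈ roots e) : IsCoprime (j : ℤ) e := by
  rw [roots, mem_filter] at hj
  obtain ⟨-, hj3⟩ := hj
  rw [Int.isCoprime_iff_gcd_eq_one]
  by_contra hne
  obtain ⟨p, hp, hpd⟩ := Nat.exists_prime_and_dvd hne
  have h1 : (p : ℤ) ∣ (Int.gcd (j : ℤ) e : ℤ) := by exact_mod_cast hpd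
  have hpj : (p : ℤ) ∣ j := h1.trans (Int.gcd_dvd_left _ _)
  have hpe : (p : ℤ) ∣ e := h1.trans (Int.gcd_dvd_right _ _)
  have h2 : (p : ℤ) ∣ 2 := by
    have : (p : ℤ) ∣ (j : ℤ) ^ 3 - ((j : ℤ) ^ 3 - 2) := dvd_sub (dvd_pow hpj (by norm_num)) (hpe.trans hj3)
    simpa using this
  have hp2 : p ∣ 2 := by exact_mod_cast h2
  have hpe' : p ∣ e := by exact_mod_cast hpe
  have := Nat.Coprime.coprime_dvd_left hpe' hodd
  exact hp.one_lt.ne' (this.eq_one_of_dvd hp2)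

/-- **The two congruences on `c` are one class modulo `es`**: for `e` odd with `j ∈ roots(e)`,
`(b, s) = 1` and `(e, s) = 1`, there is `c₀` with
`(e ∣ a + bj + cj² ∧ s ∣ a² + bc) ↔ es ∣ c − c₀` for all `c ∈ ℤ` (the class `c₃` of (4.3)).
[cite: HeathBrown2001LargestPrimeFactorCubic, (4.3)] -/
theorem exists_class {a b : ℤ} {e s j : ℕ} (he : 0 < e) (hs : 0 < s) (hje : IsCoprime (j : ℤ) e)
    (hbs : IsCoprime b (s : ℤ)) (hes : Nat.Coprime e s) :
    ∃ c₀ : ℤ, ∀ c : ℤ, ((e : ℤ) ∣ a + b * j + c * (j : ℤ) ^ 2 ∧ (s : ℤ) ∣ a ^ 2 + b * c) ↔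
      ((e * s : ℕ) : ℤ) ∣ c - c₀ := by
  obtain ⟨ji, t1, hji⟩ := hje      -- `ji * j + t1 * e = 1`
  obtain ⟨bi, t2, hbi⟩ := hbs.symm  -- `bi * b + t2 * s = 1`? careful: hbs.symm : IsCoprime s b
  -- inverses
  have hji' : (e : ℤ) ∣ ji * j - 1 := ⟨-t1, by linarith⟩
  obtain ⟨bi', t2', hbi'⟩ := hbs    -- `bi' * b + t2' * s = 1`
  have hbi2 : (s : ℤ) ∣ bi' * b - 1 := ⟨-t2', by linarith⟩
  set ce : ℤ := -(a + b * j) * ji ^ 2 with hce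
  set cs : ℤ := -(a ^ 2) * bi' with hcs
  -- CRT
  set ne : ℕ := (ce % e).toNat with hne
  set ns : ℕ := (cs % s).toNat with hns
  have hne0 : (0 : ℤ) ≤ ce % e := Int.emod_nonneg _ (by exact_mod_cast he.ne')
  have hns0 : (0 : ℤ) ≤ cs % s := Int.emod_nonneg _ (by exact_mod_cast hs.ne')
  obtain ⟨k, hk1, hk2⟩ := Nat.chineseRemainder hes ne ns
  refine ⟨k, fun c => ?_⟩
  have hke : (e : ℤ) ∣ (k : ℤ) - ce := by
    have h1 : (e : ℤ) ∣ (k : ℤ) - ne := (Nat.modEq_iff_dvd.1 hk1.symm)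
    have h2 : (e : ℤ) ∣ (ne : ℤ) - ce := by
      rw [hne, Int.toNat_of_nonneg hne0]
      exact ⟨-(ce / e), by linarith [Int.mul_ediv_add_emod ce e]⟩
    have := dvd_add h1 h2; rwa [sub_add_sub_cancel] at this
  have hks : (s : ℤ) ∣ (k : ℤ) - cs := by
    have h1 : (s : ℤ) ∣ (k : ℤ) - ns := (Nat.modEq_iff_dvd.1 hk2.symm)
    have h2 : (s : ℤ) ∣ (ns : ℤ) - cs := by
      rw [hns, Int.toNat_of_nonneg hns0]
      exact ⟨-(cs / s), by linarith [Int.mul_ediv_add_emod cs s]⟩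
    have := dvd_add h1 h2; rwa [sub_add_sub_cancel] at this
  -- the two single congruences
  have iff_e : (e : ℤ) ∣ a + b * j + c * (j : ℤ) ^ 2 ↔ (e : ℤ) ∣ c - ce := by
    constructor
    · intro h
      -- `c − ce = (a+bj+cj²) ji² − c (ji j − 1)(ji j + 1)`
      have : c - ce = (a + b * j + c * (j : ℤ) ^ 2) * ji ^ 2 - c * (ji * j - 1) * (ji * j + 1) := by
        rw [hce]; ring
      rw [this]
      exact dvd_sub (dvd_mul_of_dvd_left h _) (dvd_mul_of_dvd_left (dvd_mul_of_dvd_right hji' _) _)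
    · intro h
      -- `a+bj+cj² = (c − ce) j² + ce j² + a + bj`, and `ce j² + (a+bj) = −(a+bj)(ji² j² − 1)`
      have : a + b * j + c * (j : ℤ) ^ 2 =
          (c - ce) * (j : ℤ) ^ 2 - (a + b * j) * (ji * j - 1) * (ji * j + 1) := by
        rw [hce]; ring
      rw [this]
      exact dvd_sub (dvd_mul_of_dvd_left h _) (dvd_mul_of_dvd_left (dvd_mul_of_dvd_right hji' _) _)
  have iff_s : (s : ℤ) ∣ a ^ 2 + b * c ↔ (s : ℤ) ∣ c - cs := by
    constructor
    · intro h
      have : c - cs = (a ^ 2 + b * c) * bi' - c * (bi' * b - 1) := by rw [hcs]; ring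
      rw [this]
      exact dvd_sub (dvd_mul_of_dvd_left h _) (dvd_mul_of_dvd_right hbi2 _)
    · intro h
      have : a ^ 2 + b * c = b * (c - cs) - a ^ 2 * (bi' * b - 1) := by rw [hcs]; ring
      rw [this]
      exact dvd_sub (dvd_mul_of_dvd_right h _) (dvd_mul_of_dvd_right hbi2 _)
  rw [iff_e, iff_s]
  have hes' : IsCoprime (e : ℤ) (s : ℤ) := Nat.isCoprime_iff_coprime.2 hes
  constructor
  · rintro ⟨h1, h2⟩
    have h1' : (e : ℤ) ∣ c - k := by
      have := dvd_sub h1 hke; rwa [show c - ce - ((k : ℤ) - ce) = c - k by ring] at this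
    have h2' : (s : ℤ) ∣ c - k := by
      have := dvd_sub h2 hks; rwa [show c - cs - ((k : ℤ) - cs) = c - k by ring] at this
    push_cast
    exact hes'.mul_dvd h1' h2'
  · intro h
    push_cast at h
    have h1' : (e : ℤ) ∣ c - k := (dvd_mul_right _ _).trans h
    have h2' : (s : ℤ) ∣ c - k := (dvd_mul_left _ _).trans h
    constructor
    · have := dvd_add h1' hke; rwa [show c - (k : ℤ) + ((k : ℤ) - ce) = c - ce by ring] at this
    · have := dvd_add h2' hks; rwa [show c - (k : ℤ) + ((k : ℤ) - cs) = c - cs by ring] at this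

end Family

/-! ### Theorem 2 for one progression -/

section Thm2

variable {X : ℕ} {P : ℕ → Finset (ℕ × ℕ)}

/-- The phase of one generator: `e(h(Y/N(α_c) − ab w_c/q))`. [cite: HeathBrown2001LargestPrimeFactorCubic, Lemma 4 (σ(n))] -/
def phaseTerm (ab : ℕ × ℕ) (Y : ℕ) (h : ℤ) (c : ℕ) : ℂ :=
  (𝐞 ((h : ℝ) * ((Y : ℝ) / normNat (ab.1, ab.2, c) -
    (ab.1 : ℝ) * ab.2 * wRoot (ab.1, ab.2, c) / qf ab.1 ab.2)) : ℂ)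

/-- `q₁' = q₁/(s, q₁)`: `1` if `q₁ ∣ s`, else `q₁`. [cite: HeathBrown2001LargestPrimeFactorCubic, §5 p. 572] -/
def qRed (q1 s : ℕ) : ℕ := if q1 ∣ s then 1 else q1

/-- `wRoot` is an inverse of `C` modulo `q` whenever `(C, q) = 1` (no membership in `gens` needed).
[cite: HeathBrown2001LargestPrimeFactorCubic, (3.5)] -/
theorem wRoot_spec' {v : ℕ × ℕ × ℕ} (hC : IsCoprime (Cf v) (qf v.1 v.2.1)) :
    wRoot v * Cf v ≡ 1 [ZMOD qf v.1 v.2.1] := by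
  have hC' : IsCoprime ((v.2.1 : ℤ) ^ 2 - v.1 * v.2.2) ((v.1 : ℤ) ^ 3 - 2 * (v.2.1 : ℤ) ^ 3) := by
    simpa [Cf, qf] using hC
  rw [wRoot, dif_pos hC']
  have h := Classical.choose_spec (exists_inverse_C_mod_q hC')
  simpa [Cf, qf] using h

set_option maxHeartbeats 1600000 in
/-- **Theorem 2 applied to one progression** (§5 pp. 571–573): the sum of the phases over the `c` of
one cube in the class of `(e, j)` with `(C, q) = 1` and `s ∣ D` is at most
`(1 + (3/20)|h|) · C (q')^ε [B((h,q)/q₀)^{1/8} + B^{3/4} q₀^{1/8} + B^{1/2} q₂'^{1/2} + B^{3/4} q₁'^{1/4}]`,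
`q' = q/s`, `B = t/(100es) + 1`, `q₀ = q'/(q₁'q₂')`, given the conclusion of Theorem 2 for
`k = 2`, `D = 1` with constant `C ≥ 0`. [cite: HeathBrown2001LargestPrimeFactorCubic, §5 pp. 571–573] -/
theorem norm_inner_sum_le {ε C : ℝ} (hC0 : 0 ≤ C)
    (hThm2 : ∀ (q q₀ : ℕ) (qs : Fin 2 → ℕ) (f g : ℤ[X]) (w A : ℤ) (B : ℕ),
      q = q₀ * ∏ i, qs i → 0 < q → Squarefree q →
      f.natDegree ≤ 1 → g.natDegree ≤ 1 →
      (∀ p : ℕ, p.Prime → p ∣ q → 2 * 2 * 1 < p) →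
      (∀ p : ℕ, p.Prime → p ∣ q → ¬ ∃ h : (ZMod p)[X], h.natDegree ≤ 2 + 1 ∧
        f.map (Int.castRingHom (ZMod p)) = g.map (Int.castRingHom (ZMod p)) * h) →
      ‖shortKloostermanSum q f g w A B‖ ≤
        C * (q : ℝ) ^ ε *
          ((B : ℝ) * ((Int.gcd (q₀ : ℤ) w : ℝ) / q₀) ^ ((1 : ℝ) / 2 ^ (2 + 1)) +
            (B : ℝ) ^ (1 - (1 : ℝ) / 2 ^ 2) * ((q₀ : ℝ) / Int.gcd (q₀ : ℤ) w) ^ ((1 : ℝ) / 2 ^ (2 + 1)) +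
            ∑ j : Fin 2, (B : ℝ) ^ (1 - (1 : ℝ) / 2 ^ (j.val + 1)) *
              (qs j.rev : ℝ) ^ ((1 : ℝ) / 2 ^ (j.val + 1))))
    (hP : ∀ i, P i ⊆ basePairs X i) (hX : 1 ≤ X) {i : ℕ} (hi : i ∈ scales X)
    {ab : ℕ × ℕ} (hab : ab ∈ P i) {e j : ℕ} (he : 0 < e) (hj : j ∈ roots e)
    (hcop : Nat.Coprime e (2 * (qf ab.1 ab.2).natAbs))
    {s : ℕ} (hs : s ∈ (qf ab.1 ab.2).natAbs.divisors)
    {q1 q2 : ℕ} (hq1 : q1.Prime) (hq2 : q2.Prime) (hq12 : q1 ≠ q2)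
    (hq1d : q1 ∣ (qf ab.1 ab.2).natAbs) (hq2d : q2 ∣ (qf ab.1 ab.2).natAbs)
    {Y : ℕ} (hY : Y ≤ 2 * X) {h : ℤ} (hh : h ≠ 0) :
    ‖∑ c ∈ (bcRange (tscale X i)).filter (fun c : ℕ =>
        (e : ℤ) ∣ (ab.1 : ℤ) + ab.2 * j + (c : ℤ) * (j : ℤ) ^ 2 ∧
        Int.gcd (Cf (ab.1, ab.2, c)) (qf ab.1 ab.2) = 1 ∧
        (s : ℤ) ∣ (ab.1 : ℤ) ^ 2 + ab.2 * c), phaseTerm ab Y h c‖ ≤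
      (1 + 3 / 20 * |(h : ℝ)|) * (C * (((qf ab.1 ab.2).natAbs / s : ℕ) : ℝ) ^ ε *
        ((tscale X i / (100 * (e * s : ℕ)) + 1) *
            ((Int.gcd h (qf ab.1 ab.2) : ℝ) /
              (((qf ab.1 ab.2).natAbs / s / (qRed q1 s * qRed q2 s) : ℕ) : ℝ)) ^ ((1 : ℝ) / 8) +
          (tscale X i / (100 * (e * s : ℕ)) + 1) ^ ((3 : ℝ) / 4) *
            ((((qf ab.1 ab.2).natAbs / s / (qRed q1 s * qRed q2 s) : ℕ) : ℝ)) ^ ((1 : ℝ) / 8) +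
          (tscale X i / (100 * (e * s : ℕ)) + 1) ^ ((1 : ℝ) / 2) * (qRed q2 s : ℝ) ^ ((1 : ℝ) / 2) +
          (tscale X i / (100 * (e * s : ℕ)) + 1) ^ ((3 : ℝ) / 4) * (qRed q1 s : ℝ) ^ ((1 : ℝ) / 4))) := by
  classical
  obtain ⟨a, b⟩ := ab
  simp only at hcop hs hq1d hq2d ⊢
  set t := tscale X i with htdef
  have ht : 0 ≤ t := tscale_nonneg X i
  -- the base pair data
  have hbase : IsBasePair X (a, b) := (mem_filter.1 (hP i hab)).2
  have ha_range : a ∈ aRange t := (mem_product.1 (mem_filter.1 (hP i hab)).1).1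
  have hb_range : b ∈ bcRange t := (mem_product.1 (mem_filter.1 (hP i hab)).1).2
  obtain ⟨hsq, h6, -⟩ := hbase
  simp only at hsq h6
  set qn : ℕ := (qf a b).natAbs with hqn
  have hq0 : 0 < qf a b := by
    have := (qf_bounds ht ha_range hb_range).1
    have h' : (0 : ℝ) < qf a b := lt_of_le_of_lt (by positivity) this
    exact_mod_cast h'
  have hqn_cast : (qn : ℤ) = qf a b := Int.natAbs_of_nonneg hq0.le
  have hqn0 : 0 < qn := by rw [hqn]; exact Int.natAbs_pos.2 hq0.ne'
  have hsdvd : s ∣ qn := Nat.dvd_of_mem_divisors hs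
  have hs0 : 0 < s := Nat.pos_of_mem_divisors hs
  set q' : ℕ := qn / s with hq'
  have hqq' : qn = q' * s := (Nat.div_mul_cancel hsdvd).symm
  have hq'0 : 0 < q' := Nat.pos_of_ne_zero (fun h0 => by rw [h0, zero_mul] at hqq'; omega)
  have hcop_qs : Nat.Coprime q' s := Nat.coprime_of_squarefree_mul (hqq' ▸ hsq)
  obtain ⟨haq, hbq⟩ := isCoprime_ab_q (X := X) ⟨hsq, h6, (mem_filter.1 (hP i hab)).2.2.2⟩
  simp only at haq hbq
  -- `e` odd, coprime to `q` and to `s`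
  have he2 : Nat.Coprime e 2 := Nat.Coprime.coprime_dvd_right (dvd_mul_right 2 _) hcop
  have heq : Nat.Coprime e qn := Nat.Coprime.coprime_dvd_right (dvd_mul_left _ 2) hcop
  have hes : Nat.Coprime e s := Nat.Coprime.coprime_dvd_right hsdvd heq
  have heq' : Nat.Coprime e q' := Nat.Coprime.coprime_dvd_right (Nat.div_dvd_of_dvd hsdvd) heq
  -- CRT coefficients `s σ + q' τ = 1`
  obtain ⟨σ₁, τ₁, hστ⟩ : IsCoprime (s : ℤ) (q' : ℤ) := Nat.isCoprime_iff_coprime.2 hcop_qs.symm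
  have hστ' : (s : ℤ) * σ₁ + q' * τ₁ ≡ 1 [ZMOD (q' * s : ℕ)] := by
    rw [show (s : ℤ) * σ₁ + q' * τ₁ = 1 by linarith [hστ]]
  -- the class of `c`
  have hbs : IsCoprime (b : ℤ) (s : ℤ) := by
    refine hbq.of_isCoprime_of_dvd_right ?_
    rw [← hqn_cast]; exact_mod_cast hsdvd
  obtain ⟨c₀, hc₀⟩ := exists_class (a := (a : ℤ)) (b := (b : ℤ)) he hs0 (isCoprime_root he2 hj) hbs hes
  -- rewrite the summation set through the class and the coprimality condition on `C`
  set L : ℕ := e * s with hL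
  have hL0 : 0 < L := Nat.mul_pos he hs0
  set S := (bcRange t).filter (fun c : ℕ =>
      (e : ℤ) ∣ (a : ℤ) + b * j + (c : ℤ) * (j : ℤ) ^ 2 ∧
      Int.gcd (Cf (a, b, c)) (qf a b) = 1 ∧ (s : ℤ) ∣ (a : ℤ) ^ 2 + b * c) with hS
  set S₀ := (bcRange t).filter (fun c : ℕ => (L : ℤ) ∣ (c : ℤ) - c₀) with hS₀
  have hSS₀ : S = S₀.filter (fun c : ℕ => Int.gcd (Cf (a, b, c)) (qf a b) = 1) := by
    ext c
    simp only [hS, hS₀, mem_filter]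
    have := hc₀ c
    rw [hL]
    tauto
  -- the trivial bound takes care of an empty progression
  by_cases hempty : S₀ = ∅
  · have : S = ∅ := by rw [hSS₀, hempty, filter_empty]
    rw [this, sum_empty, norm_zero]
    have hB0 : 0 ≤ t / (100 * (L : ℕ)) + 1 := by positivity
    positivity
  have hne : S₀.Nonempty := nonempty_iff_ne_empty.2 hempty
  -- the progression `c_k = cm + L k`, `k < B`
  set cm : ℕ := S₀.min' hne with hcm
  set B : ℕ := (⌊t / 10 + t / 100⌋₊ - cm) / L + 1 with hB
  have hcm_mem : cm ∈ S₀ := min'_mem S₀ hne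
  have hcm_range : cm ∈ bcRange t := (mem_filter.1 hcm_mem).1
  have himage : S₀ = (range B).image (fun k => cm + L * k) := filter_dvd_eq_image hL0 c₀ hne
  have hmemk : ∀ k < B, cm + L * k ∈ bcRange t := by
    intro k hk
    have : cm + L * k ∈ S₀ := by rw [himage]; exact mem_image_of_mem _ (mem_range.2 hk)
    exact (mem_filter.1 this).1
  obtain ⟨hlen, hBle⟩ := card_progression_le ht hL0 hcm_range
  rw [← hB] at hBle
  have hlen' : (((B - 1 : ℕ)) : ℝ) * L < t / 100 := by rw [hB]; simpa using hlen
  -- the polynomial `g = c₄ − aL X`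
  set c4 : ℤ := (b : ℤ) ^ 2 - a * cm with hc4
  set g : ℤ[X] := Polynomial.C c4 - Polynomial.C ((a : ℤ) * L) * Polynomial.X with hg
  have hg_eval : ∀ k : ℕ, g.eval (k : ℤ) = Cf (a, b, cm + L * k) := by
    intro k; simp only [hg, hc4, Cf, eval_sub, eval_C, eval_mul, eval_X]; push_cast; ring
  have hg_deg : g.natDegree ≤ 1 := by
    rw [hg]
    refine (natDegree_sub_le _ _).trans (max_le (by simp) ?_)
    exact (natDegree_C_mul_le _ _).trans (by simp)
  -- the Theorem-2 weight `w' = σ₁ (−h a b)`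
  set w' : ℤ := σ₁ * (-(h * a * b)) with hw'
  -- Theorem 2's summand and sum
  set T : ℕ → ℂ := fun k =>
    if IsUnit (((g.eval (k : ℤ) : ℤ) : ZMod q')) then
      Complex.exp ((2 * Real.pi *
        ((((w' : ZMod q') * (((1 : ℤ[X]).eval ((-1 : ℤ) + k + 1) : ℤ) : ZMod q') *
          ((g.eval ((-1 : ℤ) + k + 1) : ℤ) : ZMod q')⁻¹).val : ℕ) : ℝ) / q' : ℝ) * Complex.I)
    else 0 with hT
  have hT_sum : ∀ n : ℕ, ∑ k ∈ range n, T k = shortKloostermanSum q' 1 g w' (-1) n := by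
    intro n
    rw [shortKloostermanSum, show (-1 : ℤ) + (n : ℕ) = -1 + n from rfl, sum_Ioc_eq_sum_range]
    refine sum_congr rfl (fun k _ => ?_)
    simp only [hT, show (-1 : ℤ) + k + 1 = (k : ℤ) by ring]
  -- Theorem 2's bound for every partial sum, monotone in the length
  set q1' := qRed q1 s with hq1'
  set q2' := qRed q2 s with hq2'
  have hq1'd : q1' ∣ q' := by
    rw [hq1', qRed]; split_ifs with h1
    · exact one_dvd _
    · have : q1 ∣ q' * s := hqq' ▸ hq1d
      exact ((Nat.Prime.dvd_mul hq1).1 this).resolve_right h1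
  have hq2'd : q2' ∣ q' := by
    rw [hq2', qRed]; split_ifs with h1
    · exact one_dvd _
    · have : q2 ∣ q' * s := hqq' ▸ hq2d
      exact ((Nat.Prime.dvd_mul hq2).1 this).resolve_right h1
  have hq12' : Nat.Coprime q1' q2' := by
    rw [hq1', hq2', qRed, qRed]; split_ifs
    · exact Nat.coprime_one_left _
    · exact Nat.coprime_one_left _
    · exact Nat.coprime_one_right _
    · exact (Nat.coprime_primes hq1 hq2).2 hq12
  have hprod_dvd : q1' * q2' ∣ q' := Nat.Coprime.mul_dvd_of_dvd_of_dvd hq12' hq1'd hq2'd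
  set q0 : ℕ := q' / (q1' * q2') with hq0'
  have hq'_eq : q' = q0 * (q1' * q2') := (Nat.div_mul_cancel hprod_dvd).symm
  have hq0pos : 0 < q0 := Nat.pos_of_ne_zero (fun h0 => by rw [h0, zero_mul] at hq'_eq; omega)
  set qs : Fin 2 → ℕ := ![q1', q2'] with hqs
  have hq'_eq2 : q' = q0 * ∏ i, qs i := by
    rw [Fin.prod_univ_two]; simpa [hqs] using hq'_eq
  have hsqq' : Squarefree q' := hsq.squarefree_of_dvd (Nat.div_dvd_of_dvd hsdvd)
  have hprime5 : ∀ p : ℕ, p.Prime → p ∣ q' → 2 * 2 * 1 < p := by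
    intro p hp hpq
    have hpqn : p ∣ qn := hpq.trans (Nat.div_dvd_of_dvd hsdvd)
    have hp6 : Nat.Coprime p 6 := Nat.Coprime.coprime_dvd_left hpqn h6
    have hp2 : p ≠ 2 := by rintro rfl; norm_num at hp6
    have hp3 : p ≠ 3 := by rintro rfl; norm_num at hp6
    have := hp.five_le_of_ne_two_of_ne_three hp2 hp3
    omega
  have hnoh : ∀ p : ℕ, p.Prime → p ∣ q' → ¬ ∃ hh : (ZMod p)[X], hh.natDegree ≤ 2 + 1 ∧
      (1 : ℤ[X]).map (Int.castRingHom (ZMod p)) = g.map (Int.castRingHom (ZMod p)) * hh := by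
    rintro p hp hpq ⟨hh, -, heq⟩
    haveI : Fact p.Prime := ⟨hp⟩
    -- `p ∤ a L`
    have hpaL : ((((a : ℤ) * L : ℤ)) : ZMod p) ≠ 0 := by
      intro h0'
      rw [ZMod.intCast_zmod_eq_zero_iff_dvd] at h0'
      have hp' : Prime (p : ℤ) := Nat.prime_iff_prime_int.1 hp
      rcases hp'.dvd_or_dvd h0' with hpa | hpL
      · -- `p ∣ a`, `p ∣ q` contradicts `(a, q) = 1`
        have hpq' : (p : ℤ) ∣ qf a b := by
          rw [← hqn_cast]; exact_mod_cast hpq.trans (Nat.div_dvd_of_dvd hsdvd)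
        exact hp'.not_unit (haq.isUnit_of_dvd' hpa hpq')
      · have hpL' : p ∣ e * s := by exact_mod_cast hpL
        rcases (Nat.Prime.dvd_mul hp).1 hpL' with hpe | hps
        · exact hp.one_lt.ne' ((Nat.Coprime.coprime_dvd_left hpe heq').eq_one_of_dvd hpq)
        · exact hp.one_lt.ne' ((Nat.Coprime.coprime_dvd_left hpq hcop_qs).eq_one_of_dvd hps)
    have hgmap : g.map (Int.castRingHom (ZMod p)) =
        Polynomial.C ((c4 : ZMod p)) - Polynomial.C (((a : ℤ) * L : ℤ) : ZMod p) * Polynomial.X := by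
      simp [hg, Polynomial.map_sub, Polynomial.map_mul]
    have hdeg1 : (g.map (Int.castRingHom (ZMod p))).natDegree = 1 := by
      rw [hgmap]
      rw [sub_eq_add_neg, add_comm, ← neg_mul, ← Polynomial.C_neg]
      rw [Polynomial.natDegree_add_C, Polynomial.natDegree_C_mul_X _ (neg_ne_zero.2 hpaL)]
    have h1map : (1 : ℤ[X]).map (Int.castRingHom (ZMod p)) = 1 := Polynomial.map_one _
    rw [h1map] at heq
    have hh0 : hh ≠ 0 := by rintro rfl; simp at heq
    have hg0 : g.map (Int.castRingHom (ZMod p)) ≠ 0 := by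
      intro h0; rw [h0] at hdeg1; simp at hdeg1
    have := congrArg Polynomial.natDegree heq
    rw [Polynomial.natDegree_one, Polynomial.natDegree_mul hg0 hh0, hdeg1] at this
    omega
  -- the bound `M` of all partial sums
  set Bs : ℝ := t / (100 * (L : ℕ)) + 1 with hBs
  have hBs1 : (B : ℝ) ≤ Bs := hBle
  have hBs0 : 0 ≤ Bs := by rw [hBs]; positivity
  set M : ℝ := C * (q' : ℝ) ^ ε *
      (Bs * ((Int.gcd h (qf a b) : ℝ) / q0) ^ ((1 : ℝ) / 8) +
        Bs ^ ((3 : ℝ) / 4) * (q0 : ℝ) ^ ((1 : ℝ) / 8) +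
        Bs ^ ((1 : ℝ) / 2) * (q2' : ℝ) ^ ((1 : ℝ) / 2) +
        Bs ^ ((3 : ℝ) / 4) * (q1' : ℝ) ^ ((1 : ℝ) / 4)) with hMdef
  -- `gcd(q0, w') ≤ gcd(h, q)` and `≥ 1`
  have hgcd_pos : 0 < Int.gcd (q0 : ℤ) w' := Int.gcd_pos_of_ne_zero_left _ (by exact_mod_cast hq0pos.ne')
  have hgcd_le : (Int.gcd (q0 : ℤ) w' : ℝ) ≤ Int.gcd h (qf a b) := by
    have hd1 : (Int.gcd (q0 : ℤ) w' : ℤ) ∣ h := by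
      -- `d ∣ w' = σ₁ (−h a b)`, and `d` is coprime to `σ₁ a b`
      have hdw : (Int.gcd (q0 : ℤ) w' : ℤ) ∣ σ₁ * (a * b) * (-h) := by
        have := Int.gcd_dvd_right (q0 : ℤ) w'
        have e1 : w' = σ₁ * (a * b) * (-h) := by rw [hw']; ring
        exact this.trans (dvd_of_eq e1)
      have hdq' : (Int.gcd (q0 : ℤ) w' : ℤ) ∣ q' := by
        have h1 := Int.gcd_dvd_left (q0 : ℤ) w'
        have h2 : (q0 : ℤ) ∣ q' := by exact_mod_cast Dvd.intro _ hq'_eq.symm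
        exact h1.trans h2
      have hcopd : IsCoprime (Int.gcd (q0 : ℤ) w' : ℤ) (σ₁ * (a * b)) := by
        refine IsCoprime.mul_right ?_ (IsCoprime.mul_right ?_ ?_)
        · -- `σ₁ s ≡ 1 (mod q')` so `(σ₁, q') = 1`
          have : IsCoprime (q' : ℤ) σ₁ := ⟨τ₁, s, by linarith [hστ]⟩
          exact this.of_isCoprime_of_dvd_left hdq'
        · have hq'q : (q' : ℤ) ∣ qf a b := by rw [← hqn_cast]; exact_mod_cast Nat.div_dvd_of_dvd hsdvd
          exact (haq.symm.of_isCoprime_of_dvd_left (hdq'.trans hq'q))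
        · have hq'q : (q' : ℤ) ∣ qf a b := by rw [← hqn_cast]; exact_mod_cast Nat.div_dvd_of_dvd hsdvd
          exact (hbq.symm.of_isCoprime_of_dvd_left (hdq'.trans hq'q))
      exact (hcopd.dvd_of_dvd_mul_left hdw).trans (neg_dvd.2 (dvd_refl h))
    have hd2 : (Int.gcd (q0 : ℤ) w' : ℤ) ∣ qf a b := by
      have h1 := Int.gcd_dvd_left (q0 : ℤ) w'
      have h2 : (q0 : ℤ) ∣ qf a b := by
        rw [← hqn_cast, hqq', hq'_eq]; push_cast
        rw [mul_assoc]; exact dvd_mul_right _ _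
      exact h1.trans h2
    have : (Int.gcd (q0 : ℤ) w' : ℤ) ∣ Int.gcd h (qf a b) := Int.dvd_coe_gcd hd1 hd2
    have hpos : 0 < Int.gcd h (qf a b) := Int.gcd_pos_of_ne_zero_left _ hh
    exact_mod_cast Int.le_of_dvd (by exact_mod_cast hpos) this
  have hM : ∀ n ≤ B, ‖∑ k ∈ range n, T k‖ ≤ M := by
    intro n hn
    rw [hT_sum]
    have hb := hThm2 q' q0 qs 1 g w' (-1) n hq'_eq2 hq'0 hsqq' (by simp) hg_deg hprime5 hnoh
    refine hb.trans ?_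
    rw [hMdef]
    refine mul_le_mul_of_nonneg_left ?_ (by positivity)
    have hn' : (n : ℝ) ≤ Bs := le_trans (by exact_mod_cast hn) hBs1
    have hn0 : (0 : ℝ) ≤ n := Nat.cast_nonneg n
    -- term by term
    have t1 : (n : ℝ) * ((Int.gcd (q0 : ℤ) w' : ℝ) / q0) ^ ((1 : ℝ) / 8) ≤
        Bs * ((Int.gcd h (qf a b) : ℝ) / q0) ^ ((1 : ℝ) / 8) := by
      refine mul_le_mul hn' (Real.rpow_le_rpow (by positivity) ?_ (by norm_num)) (by positivity) hBs0
      exact div_le_div_of_nonneg_right hgcd_le (by positivity)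
    have t2 : (n : ℝ) ^ ((3 : ℝ) / 4) * ((q0 : ℝ) / Int.gcd (q0 : ℤ) w') ^ ((1 : ℝ) / 8) ≤
        Bs ^ ((3 : ℝ) / 4) * (q0 : ℝ) ^ ((1 : ℝ) / 8) := by
      refine mul_le_mul (Real.rpow_le_rpow hn0 hn' (by norm_num)) ?_ (by positivity) (by positivity)
      refine Real.rpow_le_rpow (by positivity) ?_ (by norm_num)
      exact div_le_self (by positivity) (by exact_mod_cast hgcd_pos)
    have t3 : (n : ℝ) ^ ((1 : ℝ) / 2) * (q2' : ℝ) ^ ((1 : ℝ) / 2) ≤ Bs ^ ((1 : ℝ) / 2) * (q2' : ℝ) ^ ((1 : ℝ) / 2) :=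
      mul_le_mul_of_nonneg_right (Real.rpow_le_rpow hn0 hn' (by norm_num)) (by positivity)
    have t4 : (n : ℝ) ^ ((3 : ℝ) / 4) * (q1' : ℝ) ^ ((1 : ℝ) / 4) ≤ Bs ^ ((3 : ℝ) / 4) * (q1' : ℝ) ^ ((1 : ℝ) / 4) :=
      mul_le_mul_of_nonneg_right (Real.rpow_le_rpow hn0 hn' (by norm_num)) (by positivity)
    have er1 : ((1 : ℝ) / 2 ^ (2 + 1)) = 1 / 8 := by norm_num
    have er2 : (1 - (1 : ℝ) / 2 ^ 2) = 3 / 4 := by norm_num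
    have hsum2 : ∑ j : Fin 2, (n : ℝ) ^ (1 - (1 : ℝ) / 2 ^ (j.val + 1)) * (qs j.rev : ℝ) ^ ((1 : ℝ) / 2 ^ (j.val + 1))
        = (n : ℝ) ^ ((1 : ℝ) / 2) * (q2' : ℝ) ^ ((1 : ℝ) / 2) + (n : ℝ) ^ ((3 : ℝ) / 4) * (q1' : ℝ) ^ ((1 : ℝ) / 4) := by
      rw [Fin.sum_univ_two]
      have h0 : qs (Fin.rev 0) = q2' := rfl
      have h1 : qs (Fin.rev 1) = q1' := rfl
      rw [h0, h1]
      simp only [Fin.val_zero, Fin.val_one]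
      norm_num
    rw [hsum2, er1, er2]
    linarith [t1, t2, t3, t4]
  have hM0 : 0 ≤ M := by rw [hMdef]; positivity
  -- (ii) the sum over `S` as a sum over the progression
  have hsumS : ∑ c ∈ S, phaseTerm (a, b) Y h c =
      ∑ k ∈ (range B).filter (fun k => Int.gcd (Cf (a, b, cm + L * k)) (qf a b) = 1),
        phaseTerm (a, b) Y h (cm + L * k) := by
    rw [hSS₀, himage, filter_image]
    rw [sum_image]
    intro x _ y _ hxy
    have : L * x = L * y := by simpa using hxy
    exact Nat.eq_of_mul_eq_mul_left hL0 this
  rw [hsumS]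
  -- `good k ↔ (C_k, q) = 1`; `C_k ≡ c4 (mod s)`
  have hCk : ∀ k : ℕ, Cf (a, b, cm + L * k) = c4 - a * L * k := by
    intro k; simp only [Cf, hc4]; push_cast; ring
  have hsL : (s : ℤ) ∣ L := by rw [hL]; push_cast; exact dvd_mul_left _ _
  have hq'q : (q' : ℤ) ∣ qf a b := by rw [← hqn_cast]; exact_mod_cast Nat.div_dvd_of_dvd hsdvd
  have hsq' : (s : ℤ) ∣ qf a b := by rw [← hqn_cast]; exact_mod_cast hsdvd
  -- if `(c4, s) ≠ 1` there are no good `k`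
  by_cases hc4s : IsCoprime c4 (s : ℤ)
  swap
  · have hempty' : (range B).filter (fun k => Int.gcd (Cf (a, b, cm + L * k)) (qf a b) = 1) = ∅ := by
      refine filter_false_of_mem (fun k _ hk => hc4s ?_)
      have hco : IsCoprime (Cf (a, b, cm + L * k)) (qf a b) := Int.isCoprime_iff_gcd_eq_one.2 hk
      have hco' : IsCoprime (Cf (a, b, cm + L * k)) (s : ℤ) := hco.of_isCoprime_of_dvd_right hsq'
      rw [hCk] at hco'
      -- `c4 = (c4 − aLk) + (a k) L`, `s ∣ L`
      obtain ⟨m, hm⟩ := hsL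
      have : c4 = (c4 - a * L * k) + (a * k * m) * s := by rw [hm]; ring
      rw [this]
      exact hco'.add_mul_right_left _
    rw [hempty', sum_empty, norm_zero]
    positivity
  -- good `k` ↔ `g(k)` is a unit mod `q'`
  have hgood_iff : ∀ k : ℕ, Int.gcd (Cf (a, b, cm + L * k)) (qf a b) = 1 ↔
      IsUnit (((g.eval (k : ℤ) : ℤ) : ZMod q')) := by
    intro k
    rw [ZMod.coe_int_isUnit_iff_isCoprime, hg_eval, ← Int.isCoprime_iff_gcd_eq_one]
    constructor
    · intro hco; exact (hco.of_isCoprime_of_dvd_right hq'q).symm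
    · intro hco
      have h1 : IsCoprime (Cf (a, b, cm + L * k)) (q' : ℤ) := hco.symm
      have h2 : IsCoprime (Cf (a, b, cm + L * k)) (s : ℤ) := by
        rw [hCk]
        obtain ⟨m, hm⟩ := hsL
        have : c4 - a * L * k = c4 + (-(a * k * m)) * s := by rw [hm]; ring
        rw [this]
        exact hc4s.add_mul_right_left _
      have := h1.mul_right h2
      rwa [← Nat.cast_mul, ← hqq', hqn_cast] at this
  -- the inverses `w_k` for good `k`
  have hw : ∀ k : ℕ, Int.gcd (Cf (a, b, cm + L * k)) (qf a b) = 1 →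
      wRoot (a, b, cm + L * k) * Cf (a, b, cm + L * k) ≡ 1 [ZMOD qf a b] := by
    intro k hk
    exact wRoot_spec' (v := (a, b, cm + L * k)) (Int.isCoprime_iff_gcd_eq_one.2 hk)
  -- no good `k`: trivial
  by_cases hex : ∃ k₀, Int.gcd (Cf (a, b, cm + L * k₀)) (qf a b) = 1
  swap
  · have hempty' : (range B).filter (fun k => Int.gcd (Cf (a, b, cm + L * k)) (qf a b) = 1) = ∅ :=
      filter_false_of_mem (fun k _ hk => hex ⟨k, hk⟩)
    rw [hempty', sum_empty, norm_zero]
    positivity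
  obtain ⟨k₀, hk₀⟩ := hex
  -- the constant phase `ξ = e(τ₁ (−hab w_{k₀})/s)` and the smooth phase `Φ`
  set ξ : ℂ := (𝐞 (((τ₁ * (-(h * a * b) * wRoot (a, b, cm + L * k₀)) : ℤ) : ℝ) / (s : ℝ)) : ℂ) with hξ
  set Φ : ℕ → ℂ := fun k => (𝐞 ((h : ℝ) * ((Y : ℝ) / normf (a, b, cm + L * k))) : ℂ) with hΦ
  have hξ1 : ‖ξ‖ = 1 := Circle.norm_coe _
  -- for good `k`: `s ∣ w_k − w_{k₀}`
  have hwdiff : ∀ k : ℕ, Int.gcd (Cf (a, b, cm + L * k)) (qf a b) = 1 →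
      (s : ℤ) ∣ wRoot (a, b, cm + L * k) - wRoot (a, b, cm + L * k₀) := by
    intro k hk
    have h1 := (hw k hk).of_dvd hsq'
    have h0 := (hw k₀ hk₀).of_dvd hsq'
    -- `C_k ≡ C_{k₀} (mod s)`
    have hCC : Cf (a, b, cm + L * k) ≡ Cf (a, b, cm + L * k₀) [ZMOD s] := by
      rw [hCk, hCk, Int.modEq_iff_dvd]
      obtain ⟨m, hm⟩ := hsL
      exact ⟨-(a * m * k₀) + a * m * k, by rw [hm]; ring⟩
    have h2 : wRoot (a, b, cm + L * k) * Cf (a, b, cm + L * k₀) ≡ 1 [ZMOD s] :=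
      ((Int.ModEq.refl _).mul hCC).symm.trans h1
    have h3 : (wRoot (a, b, cm + L * k) - wRoot (a, b, cm + L * k₀)) * Cf (a, b, cm + L * k₀) ≡ 0 [ZMOD s] := by
      have := h2.sub h0
      simpa [sub_mul] using this
    have hco : IsCoprime (Cf (a, b, cm + L * k₀)) (s : ℤ) :=
      (Int.isCoprime_iff_gcd_eq_one.2 hk₀).of_isCoprime_of_dvd_right hsq'
    have h4 : (s : ℤ) ∣ (wRoot (a, b, cm + L * k) - wRoot (a, b, cm + L * k₀)) * Cf (a, b, cm + L * k₀) :=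
      (Int.modEq_zero_iff_dvd.1 h3)
    exact hco.symm.dvd_of_dvd_mul_right h4
  -- the factorisation of the phase for good `k`
  have hXt : (X : ℝ) ≤ t ^ 3 := by
    have hsc := mem_scales hi
    have hX1 : (1 : ℝ) ≤ X := by exact_mod_cast hX
    have : (X : ℝ) ≤ (X : ℝ) ^ (1 + 3 * hbδ / 2) := by
      calc (X : ℝ) = (X : ℝ) ^ (1 : ℝ) := (Real.rpow_one _).symm
        _ ≤ _ := Real.rpow_le_rpow_of_exponent_le hX1 (by linarith [hbδ_pos])
    nlinarith [this, hsc, pow_nonneg ht 3]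
  have hfactor : ∀ k < B, Int.gcd (Cf (a, b, cm + L * k)) (qf a b) = 1 →
      phaseTerm (a, b) Y h (cm + L * k) = Φ k * ξ * T k := by
    intro k hkB hk
    have hunit : IsUnit (((g.eval (k : ℤ) : ℤ) : ZMod q')) := (hgood_iff k).1 hk
    -- split `e(h(Y/N − abw/q)) = e(hY/N) · e(x/q)`, `x = −hab w`
    set wk : ℤ := wRoot (a, b, cm + L * k) with hwk
    set x : ℤ := -(h * a * b) * wk with hx
    have hN : (normNat (a, b, cm + L * k) : ℝ) = normf (a, b, cm + L * k) :=
      normNat_real_eq ht ha_range hb_range (hmemk k hkB)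
    have hqR : ((qf a b : ℤ) : ℝ) = ((q' * s : ℕ) : ℝ) := by
      rw [← hqn_cast, hqq']; push_cast; ring
    have e1 : phaseTerm (a, b) Y h (cm + L * k) = Φ k * (𝐞 ((x : ℝ) / ((q' * s : ℕ) : ℝ)) : ℂ) := by
      rw [phaseTerm, hΦ]
      simp only
      rw [← Circle.coe_mul, ← AddChar.map_add_eq_mul]
      congr 2
      rw [hN, ← hqR, hx, hwk]
      push_cast
      ring
    rw [e1, fourierChar_crt_split hq'0 hs0 hστ' x]
    -- the `q'`-part is `T k`
    have e2 : (𝐞 (((σ₁ * x : ℤ)) / (q' : ℝ)) : ℂ) = T k := by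
      rw [show (((σ₁ * x : ℤ)) : ℝ) / (q' : ℝ) = ((σ₁ * x : ℤ) : ℝ) / (q' : ℕ) from rfl,
        fourierChar_intCast_div_eq_exp hq'0]
      simp only [hT, hunit, if_true, show (-1 : ℤ) + k + 1 = (k : ℤ) by ring, eval_one, Int.cast_one, mul_one]
      congr 6
      -- `(σ₁ x : ZMod q') = w' * (g k)⁻¹`
      have hinv : (((g.eval (k : ℤ) : ℤ)) : ZMod q')⁻¹ = (wk : ZMod q') := by
        apply ZMod.inv_eq_of_mul_eq_one
        have h1 := (hw k hk).of_dvd hq'q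
        rw [hg_eval]
        have : (((wk * Cf (a, b, cm + L * k) : ℤ)) : ZMod q') = ((1 : ℤ) : ZMod q') :=
          (ZMod.intCast_eq_intCast_iff _ _ _).2 h1
        push_cast at this
        rw [mul_comm] at this
        exact this
      rw [hinv, hx, hw']
      push_cast
      ring
    -- the `s`-part is `ξ`
    have e3 : (𝐞 (((τ₁ * x : ℤ)) / (s : ℝ)) : ℂ) = ξ := by
      rw [hξ]
      obtain ⟨m, hm⟩ := hwdiff k hk
      have : ((τ₁ * x : ℤ) : ℝ) / (s : ℝ) =
          ((τ₁ * (-(h * a * b) * wRoot (a, b, cm + L * k₀)) : ℤ) : ℝ) / (s : ℝ) + ((τ₁ * (-(h * a * b)) * m : ℤ) : ℝ) := by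
        have hs0' : (s : ℝ) ≠ 0 := by exact_mod_cast hs0.ne'
        rw [hx, hwk, show wRoot (a, b, cm + L * k) = wRoot (a, b, cm + L * k₀) + s * m by linarith [hm]]
        push_cast
        field_simp
        ring
      rw [this, FejerCounting.fourierChar_add_intCast]
    rw [e2, e3]
    ring
  -- the filtered sum as `∑_{k<B} (Φ k ξ) T k`
  have hsum_eq : ∑ k ∈ (range B).filter (fun k => Int.gcd (Cf (a, b, cm + L * k)) (qf a b) = 1),
      phaseTerm (a, b) Y h (cm + L * k) = ∑ k ∈ range B, (Φ k * ξ) * T k := by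
    rw [sum_filter]
    refine sum_congr rfl (fun k hk => ?_)
    rw [mem_range] at hk
    split_ifs with hgk
    · exact hfactor k hk hgk
    · have : ¬ IsUnit (((g.eval (k : ℤ) : ℤ) : ZMod q')) := fun hu => hgk ((hgood_iff k).2 hu)
      simp only [hT, this, if_false, mul_zero]
  rw [hsum_eq]
  -- Abel summation
  have hφ : ∀ k, ‖Φ k * ξ‖ ≤ 1 := by
    intro k; rw [norm_mul, hξ1, mul_one, hΦ]; exact le_of_eq (Circle.norm_coe _)
  have hV : ∑ k ∈ range (B - 1), ‖Φ (k + 1) * ξ - Φ k * ξ‖ ≤ 3 / 20 * |(h : ℝ)| := by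
    have hY0 : (0 : ℝ) ≤ Y := Nat.cast_nonneg Y
    have hY' : (Y : ℝ) ≤ 2 * X := by exact_mod_cast hY
    refine le_trans (le_of_eq ?_) (tv_phase_le ht hXt hY0 hY' ha_range hb_range hmemk hlen' h)
    refine sum_congr rfl (fun k _ => ?_)
    rw [← sub_mul, norm_mul, hξ1, mul_one]
  have := norm_sum_range_mul_le B (fun k => Φ k * ξ) T hM0 hM hφ hV
  simpa only [hMdef] using this

/-- The bound of `norm_inner_sum_le` as a function of the data:
`(1 + (3/20)|h|) C (q/s)^ε [B((h,q)/q₀)^{1/8} + B^{3/4}q₀^{1/8} + B^{1/2}q₂'^{1/2} + B^{3/4}q₁'^{1/4}]`,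
`B = t/(100es) + 1`, `q₀ = (q/s)/(q₁'q₂')`. [cite: HeathBrown2001LargestPrimeFactorCubic, §5 p. 572] -/
def thm2Bound (C ε t : ℝ) (e s qn q1 q2 : ℕ) (h : ℤ) (q : ℤ) : ℝ :=
  (1 + 3 / 20 * |(h : ℝ)|) * (C * (((qn / s : ℕ)) : ℝ) ^ ε *
    ((t / (100 * (e * s : ℕ)) + 1) *
        ((Int.gcd h q : ℝ) / (((qn / s / (qRed q1 s * qRed q2 s) : ℕ) : ℝ))) ^ ((1 : ℝ) / 8) +
      (t / (100 * (e * s : ℕ)) + 1) ^ ((3 : ℝ) / 4) *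
        (((qn / s / (qRed q1 s * qRed q2 s) : ℕ) : ℝ)) ^ ((1 : ℝ) / 8) +
      (t / (100 * (e * s : ℕ)) + 1) ^ ((1 : ℝ) / 2) * (qRed q2 s : ℝ) ^ ((1 : ℝ) / 2) +
      (t / (100 * (e * s : ℕ)) + 1) ^ ((3 : ℝ) / 4) * (qRed q1 s : ℝ) ^ ((1 : ℝ) / 4)))

/-- `thm2Bound ≥ 0` for `C ≥ 0`, `t ≥ 0`. [folklore] -/
theorem thm2Bound_nonneg {C ε t : ℝ} (hC : 0 ≤ C) (ht : 0 ≤ t) (e s qn q1 q2 : ℕ) (h : ℤ) (q : ℤ) :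
    0 ≤ thm2Bound C ε t e s qn q1 q2 h q := by
  unfold thm2Bound; positivity

/-- Möbius inversion of the condition `(D, q) = 1` ((2.11)) over `s ∣ q`:
`[(D, q) = 1] = ∑_{s ∣ q} μ(s) [s ∣ D]`. [cite: HeathBrown2001LargestPrimeFactorCubic, §4 p. 569] -/
theorem ite_gcd_eq_one_eq_sum {q : ℤ} (hq : q ≠ 0) (D : ℤ) :
    (if Int.gcd D q = 1 then (1 : ℂ) else 0) =
      ∑ s ∈ q.natAbs.divisors, ((ArithmeticFunction.moebius s : ℤ) : ℂ) * (if (s : ℤ) ∣ D then 1 else 0) := by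
  rw [← sum_divisors_moebius_complex (Int.gcd D q)]
  simp_rw [mul_ite, mul_one, mul_zero]
  rw [← sum_filter]
  refine sum_congr ?_ (fun _ _ => rfl)
  ext s
  simp only [Nat.mem_divisors, mem_filter, Int.natCast_dvd, ne_eq, Int.natAbs_eq_zero]
  constructor
  · rintro ⟨hs, -⟩
    have h1 : s ∣ D.natAbs := hs.trans (Int.natCast_dvd.1 (Int.gcd_dvd_left D q))
    have h2 : s ∣ q.natAbs := hs.trans (Int.natCast_dvd.1 (Int.gcd_dvd_right D q))
    exact ⟨⟨h2, hq⟩, h1⟩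
  · rintro ⟨⟨h2, -⟩, h1⟩
    refine ⟨Nat.dvd_gcd h1 h2, ?_⟩
    exact Nat.pos_iff_ne_zero.1 (Int.gcd_pos_of_ne_zero_right _ hq)

/-- **Heath-Brown's §5 bound for `σ(n)` of one family, conditionally on Theorem 2** (see the module
docstring): for `h ≠ 0`, `Y ≤ 2X`, `e` odd and coprime to `q` with a root `j`,
`|σ_Y(h)| ≤ ∑_{s ∣ q} thm2Bound(s)`. [cite: HeathBrown2001LargestPrimeFactorCubic, §5 pp. 571–573] -/
theorem norm_sigmaF_le {ε C : ℝ} (hC0 : 0 ≤ C)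
    (hThm2 : ∀ (q q₀ : ℕ) (qs : Fin 2 → ℕ) (f g : ℤ[X]) (w A : ℤ) (B : ℕ),
      q = q₀ * ∏ i, qs i → 0 < q → Squarefree q →
      f.natDegree ≤ 1 → g.natDegree ≤ 1 →
      (∀ p : ℕ, p.Prime → p ∣ q → 2 * 2 * 1 < p) →
      (∀ p : ℕ, p.Prime → p ∣ q → ¬ ∃ h : (ZMod p)[X], h.natDegree ≤ 2 + 1 ∧
        f.map (Int.castRingHom (ZMod p)) = g.map (Int.castRingHom (ZMod p)) * h) →
      ‖shortKloostermanSum q f g w A B‖ ≤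
        C * (q : ℝ) ^ ε *
          ((B : ℝ) * ((Int.gcd (q₀ : ℤ) w : ℝ) / q₀) ^ ((1 : ℝ) / 2 ^ (2 + 1)) +
            (B : ℝ) ^ (1 - (1 : ℝ) / 2 ^ 2) * ((q₀ : ℝ) / Int.gcd (q₀ : ℤ) w) ^ ((1 : ℝ) / 2 ^ (2 + 1)) +
            ∑ j : Fin 2, (B : ℝ) ^ (1 - (1 : ℝ) / 2 ^ (j.val + 1)) *
              (qs j.rev : ℝ) ^ ((1 : ℝ) / 2 ^ (j.val + 1))))
    (hP : ∀ i, P i ⊆ basePairs X i) (hX : 1 ≤ X) {i : ℕ} (hi : i ∈ scales X)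
    {ab : ℕ × ℕ} (hab : ab ∈ P i) {e j : ℕ} (he : 0 < e) (hj : j ∈ roots e)
    (hcop : Nat.Coprime e (2 * (qf ab.1 ab.2).natAbs))
    {q1 q2 : ℕ} (hq1 : q1.Prime) (hq2 : q2.Prime) (hq12 : q1 ≠ q2)
    (hq1d : q1 ∣ (qf ab.1 ab.2).natAbs) (hq2d : q2 ∣ (qf ab.1 ab.2).natAbs)
    {Y : ℕ} (hY : Y ≤ 2 * X) {h : ℤ} (hh : h ≠ 0) :
    ‖sigmaF X i ab e j Y h‖ ≤ ∑ s ∈ (qf ab.1 ab.2).natAbs.divisors,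
      thm2Bound C ε (tscale X i) e s (qf ab.1 ab.2).natAbs q1 q2 h (qf ab.1 ab.2) := by
  classical
  have ht : 0 ≤ tscale X i := tscale_nonneg X i
  have ha_range : ab.1 ∈ aRange (tscale X i) := (mem_product.1 (mem_filter.1 (hP i hab)).1).1
  have hb_range : ab.2 ∈ bcRange (tscale X i) := (mem_product.1 (mem_filter.1 (hP i hab)).1).2
  have hq0 : qf ab.1 ab.2 ≠ 0 := by
    have := (qf_bounds ht ha_range hb_range).1
    have h' : (0 : ℝ) < qf ab.1 ab.2 := lt_of_le_of_lt (by positivity) this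
    have h'' : (0 : ℤ) < qf ab.1 ab.2 := by exact_mod_cast h'
    exact h''.ne'
  -- the family as `base.filter ((D, q) = 1)`
  set base := (bcRange (tscale X i)).filter (fun c : ℕ =>
      (e : ℤ) ∣ (ab.1 : ℤ) + ab.2 * j + (c : ℤ) * (j : ℤ) ^ 2 ∧
      Int.gcd (Cf (ab.1, ab.2, c)) (qf ab.1 ab.2) = 1) with hbase
  have hfam : famF X i ab e j = base.filter (fun c : ℕ =>
      Int.gcd ((ab.1 : ℤ) ^ 2 + ab.2 * c) (qf ab.1 ab.2) = 1) := by
    ext c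
    simp only [famF, cSet, hbase, mem_filter, Cf]
    tauto
  have hsigma : sigmaF X i ab e j Y h = ∑ c ∈ famF X i ab e j, phaseTerm ab Y h c := rfl
  rw [hsigma, hfam, sum_filter]
  have hstep : ∑ c ∈ base, (if Int.gcd ((ab.1 : ℤ) ^ 2 + ab.2 * c) (qf ab.1 ab.2) = 1 then
      phaseTerm ab Y h c else 0) =
      ∑ s ∈ (qf ab.1 ab.2).natAbs.divisors, ((ArithmeticFunction.moebius s : ℤ) : ℂ) *
        ∑ c ∈ base.filter (fun c : ℕ => (s : ℤ) ∣ (ab.1 : ℤ) ^ 2 + ab.2 * c), phaseTerm ab Y h c := by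
    calc ∑ c ∈ base, (if Int.gcd ((ab.1 : ℤ) ^ 2 + ab.2 * c) (qf ab.1 ab.2) = 1 then phaseTerm ab Y h c else 0)
        = ∑ c ∈ base, (if Int.gcd ((ab.1 : ℤ) ^ 2 + ab.2 * c) (qf ab.1 ab.2) = 1 then (1 : ℂ) else 0) *
            phaseTerm ab Y h c := by
          refine sum_congr rfl (fun c _ => ?_); split_ifs <;> simp
      _ = ∑ c ∈ base, ∑ s ∈ (qf ab.1 ab.2).natAbs.divisors,
            ((ArithmeticFunction.moebius s : ℤ) : ℂ) * ((if (s : ℤ) ∣ (ab.1 : ℤ) ^ 2 + ab.2 * c then 1 else 0) *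
              phaseTerm ab Y h c) := by
          refine sum_congr rfl (fun c _ => ?_)
          rw [ite_gcd_eq_one_eq_sum hq0, sum_mul]
          refine sum_congr rfl (fun s _ => ?_); ring
      _ = ∑ s ∈ (qf ab.1 ab.2).natAbs.divisors, ((ArithmeticFunction.moebius s : ℤ) : ℂ) *
            ∑ c ∈ base, (if (s : ℤ) ∣ (ab.1 : ℤ) ^ 2 + ab.2 * c then 1 else 0) * phaseTerm ab Y h c := by
          rw [sum_comm]; simp_rw [mul_sum]
      _ = _ := by
          refine sum_congr rfl (fun s _ => ?_)
          congr 1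
          conv_rhs => rw [sum_filter]
          refine sum_congr rfl (fun c _ => ?_); split_ifs <;> simp
  rw [hstep]
  refine (norm_sum_le _ _).trans (sum_le_sum (fun s hs => ?_))
  rw [norm_mul]
  have hμ : ‖((ArithmeticFunction.moebius s : ℤ) : ℂ)‖ ≤ 1 := by
    rw [Complex.norm_intCast]
    exact_mod_cast ArithmeticFunction.abs_moebius_le_one
  have hinner := norm_inner_sum_le hC0 hThm2 hP hX hi hab he hj hcop hs hq1 hq2 hq12 hq1d hq2d hY hh
  have hset : base.filter (fun c : ℕ => (s : ℤ) ∣ (ab.1 : ℤ) ^ 2 + ab.2 * c) =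
      (bcRange (tscale X i)).filter (fun c : ℕ =>
        (e : ℤ) ∣ (ab.1 : ℤ) + ab.2 * j + (c : ℤ) * (j : ℤ) ^ 2 ∧
        Int.gcd (Cf (ab.1, ab.2, c)) (qf ab.1 ab.2) = 1 ∧
        (s : ℤ) ∣ (ab.1 : ℤ) ^ 2 + ab.2 * c) := by
    rw [hbase, filter_filter]
    refine filter_congr (fun c _ => ?_); tauto
  rw [hset]
  have hb0 : 0 ≤ thm2Bound C ε (tscale X i) e s (qf ab.1 ab.2).natAbs q1 q2 h (qf ab.1 ab.2) :=
    thm2Bound_nonneg hC0 ht _ _ _ _ _ _ _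
  calc ‖((ArithmeticFunction.moebius s : ℤ) : ℂ)‖ * _ ≤ 1 * thm2Bound C ε (tscale X i) e s (qf ab.1 ab.2).natAbs q1 q2 h (qf ab.1 ab.2) :=
        mul_le_mul hμ hinner (norm_nonneg _) zero_le_one
    _ = _ := one_mul _

end Thm2

end Literature.NumberTheory.Sieve.LargestPrimeFactorCubic
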